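import Mathlib
import Literature.AlgebraicGeometry.Resolution.WeightedResolutionDatum
import Literature.AlgebraicGeometry.Resolution.CobordantBlowupGlobal
import Literature.AlgebraicGeometry.Resolution.Blowups
import Literature.AlgebraicGeometry.Resolution.BlowupPrincipalCharts
import Summits.ResolutionOfSingularities.ResolutionOfSingularities.Theorems.WeightedInvariantDefs
import Summits.ResolutionOfSingularities.ResolutionOfSingularities.Theorems.WeightedInvariantDatumToEmbeddedAtlasDefs
import Summits.ResolutionOfSingularities.ResolutionOfSingularities.Theorems.WeightedInvariantDatumToEmbeddedAtlasLemmas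
import Summits.ResolutionOfSingularities.ResolutionOfSingularities.Theorems.WeightedInvariantDatumToEmbeddedAtlasBridge
import Summits.ResolutionOfSingularities.ResolutionOfSingularities.Theorems.WeightedInvariantDatumToEmbeddedAtlasCharts
import Summits.ResolutionOfSingularities.ResolutionOfSingularities.Theorems.WeightedInvariantDatumToEmbeddedLift
import HarnessLib

/-!
# The graded atlas of rank `j + 1` on the blow-up downstairs (crux `DatumToEmbedded`, line `Sketch`)

Topic: `Summits/ResolutionOfSingularities/ResolutionOfSingularities/Theorems`. Stub `stub_qs_atlas`
(the lead's, XL) of the line `Sketch` of the crux `Theses.WeightedInvariant.DatumToEmbedded`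
(statement `stmt-ResolutionOfSingularities-0572`) of the summit
`Summit.ResolutionOfSingularities.ResolutionOfSingularities`.

Setting (J. Włodarczyk, arXiv:2203.03090, §2.3.3: the torus quotient of the cobordant blow-up
`B₊` is the blow-up of the quotient downstairs). A closed immersion `i : X ⟶ Y` of an integral
`X` into `f : Y → Spec k` smooth separated quasi-compact over a perfect field, a torus-quotient
presentation `q : X ⟶ V` of rank `j` (`𝒜 : GradedAtlas j f i q`, `Theorems/WeightedInvariantDefs`),
the Rees filtration `R'` of the centre `J = D.centre f (ker i)` with its global cobordant blow-up
`π₊ : B₊ = R'.plus ⟶ Y`, the integral strict transform `X' = V(R'.strictTransformPlus (ker i))`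
(`i' : X' ⟶ B₊`, `σX : X' ⟶ X`), a Veronese degree `Dg > 0` with the exceptional identity (A1),
the Veronese generation (A2) and `K·𝒪_{X'} = (t⁻¹)^{Dg}` (A3) for the downstairs centre
`K = ker (V(J_{Dg}|_X) ⟶ V)`, a blow-up `ρ : V' ⟶ V` along `K` (`V'` integral) and
`q' : X' ⟶ V'` over `X ⟶ V`.

`stub_qs_atlas` ASSEMBLES `GradedAtlas (j + 1) (π₊ ≫ f) i' q'` from two hypotheses proved
elsewhere in the line: the AMBIENT statement (for a chart `a` and a degree-`0` `β ∈ J_{Dg}(W a)`,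
an `AmbientChart` `W' = D(β t^{Dg}) ⊆ B₊` with the contraction property,
`Theorems/…AtlasDefs.lean`) and the QUOTIENT statement (for `b ∈ K(U a)` with `i♯β = q♯b`:
`X' ∩ W' = q'⁻¹(V'[U a, b])` for the principal chart `V'[U a, b]` of `ρ`, whose sections are the
`ρ♯c/ρ♯b^l`, `c ∈ K(U a)^l`, with `q'♯` injective on it):

* index set `Σ a, (generators of K(U a))` (finitely many: `V` is locally Noetherian), charts
  `U (a, b) = V'[U a, b]` (affine, `IsBlowup.isAffineOpen_blowupChart`; they cover `V'` since the
  principal charts at generators cover `ρ⁻¹(U a)`, `…AtlasCharts.exists_mem_blowupChart`) and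
  `W (a, b) = D(β t^{Dg})` for a degree-`0` lift `β` of `b` (`…AtlasLemmas.exists_degreeZero_lift`);
* grading, constants, homogeneity of the ideal of `X'` from the ambient chart;
* `q'♯ : Γ(V', U) ≅ {degree-(0,0) sections on X' ∩ W}`: `…AtlasCharts.exists_lift_chart`,
  `exists_preimage_chart` (lifting `exists_lift_pow` / Veronese descent `exists_preimage_pow` of
  `…AtlasLemmas`, and the cancellation of the non-zero-divisor `E = i'♯(η (t⁻¹)^{Dg}) = q'♯ρ♯b` of
  `…AtlasBridge`, `t⁻¹ ≢ 0` on `X'` by `…Lift.nonempty_preimage_basicOpen`), injectivity from (Q4);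
* exponent `e · Dg` and the homogeneous units `π₊♯u · η^{e m}` (`…AtlasCharts.exists_unit_chart`).

All proofs are glue on Mathlib and the tree; no definitions, no named facts.
-/

noncomputable section

open CategoryTheory CategoryTheory.Limits AlgebraicGeometry TopologicalSpace
open Literature.AlgebraicGeometry.Resolution
open Summit.ResolutionOfSingularities.ResolutionOfSingularities.Theses.WeightedInvariant
open Summit.ResolutionOfSingularities.ResolutionOfSingularities.Theorems

set_option linter.dupNamespace false -- mandated namespace `…Theorems.DatumToEmbedded.<Topic>`
-- `Γ(B₊, W')` versus `presheaf.obj` inside `rw` motives and instance problems on the glued scheme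
-- `R'.cobordantBlowup` / `R'.plus` (as in `…DatumToEmbedded.AtlasAmbientChart`):
set_option backward.isDefEq.respectTransparency false

namespace Summit.ResolutionOfSingularities.ResolutionOfSingularities.Theorems.DatumToEmbedded.Atlas

/-! ## The cover of `V'` by the principal charts (registered sub-goal) -/

/-- **Registered sub-goal `stub_qs_atlasCover`** of the lead's `stub_qs_atlas` (step "cover" of
the assembly): for a blow-up `ρ : V' ⟶ V` along `K`, affine opens `U a` covering `V` and finite
generating sets `s a` of the `K(U a)`, the principal charts `V'[U a, b]`, `b ∈ s a`, cover `V'`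
(`ρ v ∈ U a` for some `a`, and the charts at generators cover `ρ⁻¹(U a)`,
`IsBlowup.iSup_blowupChart`). [cite: StacksProject, Tag 0804] -/
theorem stub_qs_atlasCover :
    ∀ {V V' : Scheme.{0}} {ρ : V' ⟶ V} {K : V.IdealSheafData}, IsBlowup ρ K →
      ∀ {ι : Type} (U : ι → V.affineOpens), ⨆ a, (U a : V.Opens) = ⊤ →
      ∀ (s : ∀ a, Finset Γ(V, U a)), (∀ a, Ideal.span (s a : Set Γ(V, U a)) = K.ideal (U a)) →
      ⨆ ab : (Σ a, ↥(s a)), blowupChart ρ K (U ab.1) (ab.2 : Γ(V, U ab.1)) = ⊤ := by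
  intro V V' ρ K hρ ι U hU s hs
  refine top_le_iff.mp fun v _ => ?_
  have hv : ρ v ∈ (⊤ : V.Opens) := trivial
  rw [← hU, Opens.mem_iSup] at hv
  obtain ⟨a, ha⟩ := hv
  obtain ⟨b, hb⟩ := exists_mem_blowupChart hρ (U a) (s a) (hs a) ha
  exact Opens.mem_iSup.mpr ⟨⟨a, b⟩, hb⟩

/-! ## The stub -/

/-- **STUB `stub_qs_atlas`** of the line `Sketch` of crux `DatumToEmbedded` (the lead's): **the
graded atlas of rank `j + 1` on the blow-up downstairs.** Given the AMBIENT statement (the charts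
`D(β t^{Dg}) ⊆ B₊` with their `ℤʲ⁺¹`-grading, unit `η = β t^{Dg}` and contraction property) and
the QUOTIENT statement (under such a chart the strict transform is the preimage of the principal
chart `V'[U a, b]` of the blow-up `ρ : V' ⟶ V` along `K`, whose sections are the `ρ♯c/ρ♯b^l` and
on which `q'♯` is injective), the pair `(B₊ ⟶ Spec k, i' : X' ⟶ B₊)` is presented by
`q' : X' ⟶ V'`: charts indexed by the finitely many generators `b` of the `K(U a)` and their
degree-`0` lifts `β`, `q'♯ : Γ(V', V'[U a, b]) ≅` the degree-`(0,0)` sections on `X' ∩ D(β t^{Dg})`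
(lift / descend through `K(U a)^l ↔ J_{Dg l}(W a) ∩ A₀` and cancel the non-zero-divisor
`i'♯(η (t⁻¹)^{Dg}) = q'♯ρ♯b`), homogeneous units `π₊♯u · η^{e m}` of all degrees in
`(e Dg)·ℤʲ⁺¹`, exponent `e · Dg`. [cite: Wlodarczyk2022, §2.3.3] -/
theorem stub_qs_atlas :
    (∀ {p : ℕ} (D : WeightedResolutionDatum p) {k : Type} [Field k] [CharP k p] [PerfectField k]
      {Y X V : Scheme.{0}} (f : Y ⟶ Spec (.of k)) [Smooth f] [IsSeparated f] [QuasiCompact f]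
      (i : X ⟶ Y) [IsClosedImmersion i] [IsIntegral X] (q : X ⟶ V) [IsIntegral V]
      (g : V ⟶ Spec (.of k)) [IsSeparated g] [LocallyOfFiniteType g] [QuasiCompact g],
      q ≫ g = i ≫ f →
      ∀ {j : ℕ} (𝒜 : GradedAtlas j f i q), (∃ y : Y, ¬ IsBot (D.inv f i.ker y)) →
      (∀ (a : 𝒜.ι) (n : ℕ), @Ideal.IsHomogeneous (Fin j → ℤ) (AddSubgroup Γ(Y, 𝒜.W a))
        Γ(Y, 𝒜.W a) _ _ _ (𝒜.piece a) _ _ (𝒜.gradedRing a)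
        (((D.centre f i.ker).piece n).ideal (𝒜.W a))) →
      ∀ (R' : ReesFiltration Y), R'.ideal = (D.centre f i.ker).piece →
      ∀ [Smooth (R'.πPlus ≫ f)] [IsSeparated (R'.πPlus ≫ f)] [QuasiCompact (R'.πPlus ≫ f)]
      (Dg : ℕ), 0 < Dg →
      ((D.centre f i.ker).piece Dg).comap R'.πPlus = R'.excPlus ^ Dg →
      ∀ (a : 𝒜.ι) (β : Γ(Y, 𝒜.W a)), β ∈ ((D.centre f i.ker).piece Dg).ideal (𝒜.W a) →
        β ∈ 𝒜.piece a 0 →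
        ∃ 𝒞 : AmbientChart j f i q 𝒜 (D.centre f i.ker).piece R' Dg a β,
          ∀ x : Γ(Y, 𝒜.W a), R'.πPlus.appLE (𝒜.W a) 𝒞.W' 𝒞.le_preimage x ∈
            (R'.strictTransformPlus i.ker).ideal 𝒞.W' → x * β ∈ i.ker.ideal (𝒜.W a)) →
    (∀ {p : ℕ} (D : WeightedResolutionDatum p) {k : Type} [Field k] [CharP k p] [PerfectField k]
      {Y X V : Scheme.{0}} (f : Y ⟶ Spec (.of k)) [Smooth f] [IsSeparated f] [QuasiCompact f]
      (i : X ⟶ Y) [IsClosedImmersion i] [IsIntegral X] (q : X ⟶ V) [IsIntegral V]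
      (g : V ⟶ Spec (.of k)) [IsSeparated g] [LocallyOfFiniteType g] [QuasiCompact g],
      q ≫ g = i ≫ f →
      ∀ {j : ℕ} (𝒜 : GradedAtlas j f i q), (∃ y : Y, ¬ IsBot (D.inv f i.ker y)) →
      ∀ (R' : ReesFiltration Y), R'.ideal = (D.centre f i.ker).piece →
      ∀ [IsIntegral (R'.strictTransformPlus i.ker).subscheme]
        (σX : (R'.strictTransformPlus i.ker).subscheme ⟶ X),
        σX ≫ i = (R'.strictTransformPlus i.ker).subschemeι ≫ R'.πPlus →
      ∀ (Dg : ℕ), 0 < Dg →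
      ((D.centre f i.ker).piece Dg).comap R'.πPlus = R'.excPlus ^ Dg →
      (((((D.centre f i.ker).piece Dg).comap i).subschemeι ≫ q).ker).comap (σX ≫ q) =
          (R'.excPlus.comap (R'.strictTransformPlus i.ker).subschemeι) ^ Dg →
      ∀ (V' : Scheme.{0}) (ρ : V' ⟶ V),
        IsBlowup ρ (((((D.centre f i.ker).piece Dg).comap i).subschemeι ≫ q).ker) →
        ∀ [IsIntegral V'] (q' : (R'.strictTransformPlus i.ker).subscheme ⟶ V'),
          q' ≫ ρ = σX ≫ q →
      ∀ (a : 𝒜.ι) (b : Γ(V, 𝒜.U a)),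
        b ∈ (((((D.centre f i.ker).piece Dg).comap i).subschemeι ≫ q).ker).ideal (𝒜.U a) →
      ∀ (β : Γ(Y, 𝒜.W a)),
        i.app (𝒜.W a) β = q.appLE (𝒜.U a) (i ⁻¹ᵁ (𝒜.W a)) (𝒜.preimage_eq a).le b →
      ∀ (𝒞 : AmbientChart j f i q 𝒜 (D.centre f i.ker).piece R' Dg a β),
        (∀ x : Γ(Y, 𝒜.W a), R'.πPlus.appLE (𝒜.W a) 𝒞.W' 𝒞.le_preimage x ∈
            (R'.strictTransformPlus i.ker).ideal 𝒞.W' → x * β ∈ i.ker.ideal (𝒜.W a)) →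
        (R'.strictTransformPlus i.ker).subschemeι ⁻¹ᵁ (𝒞.W' : (R'.plus : Scheme.{0}).Opens) =
          q' ⁻¹ᵁ blowupChart ρ (((((D.centre f i.ker).piece Dg).comap i).subschemeι ≫ q).ker) (𝒜.U a) b ∧
        ρ.appLE (𝒜.U a) (blowupChart ρ (((((D.centre f i.ker).piece Dg).comap i).subschemeι ≫ q).ker) (𝒜.U a) b)
            (blowupChart_le_preimage ρ (((((D.centre f i.ker).piece Dg).comap i).subschemeι ≫ q).ker) (𝒜.U a) b) b ∈
          nonZeroDivisors Γ(V', blowupChart ρ (((((D.centre f i.ker).piece Dg).comap i).subschemeι ≫ q).ker) (𝒜.U a) b) ∧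
        (∀ c' : Γ(V', blowupChart ρ (((((D.centre f i.ker).piece Dg).comap i).subschemeι ≫ q).ker) (𝒜.U a) b), ∃ (l : ℕ) (c : Γ(V, 𝒜.U a)),
          c ∈ (((((D.centre f i.ker).piece Dg).comap i).subschemeι ≫ q).ker).ideal (𝒜.U a) ^ l ∧
          c' * ρ.appLE (𝒜.U a) (blowupChart ρ (((((D.centre f i.ker).piece Dg).comap i).subschemeι ≫ q).ker) (𝒜.U a) b)
              (blowupChart_le_preimage ρ (((((D.centre f i.ker).piece Dg).comap i).subschemeι ≫ q).ker) (𝒜.U a) b) b ^ l =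
            ρ.appLE (𝒜.U a) (blowupChart ρ (((((D.centre f i.ker).piece Dg).comap i).subschemeι ≫ q).ker) (𝒜.U a) b)
              (blowupChart_le_preimage ρ (((((D.centre f i.ker).piece Dg).comap i).subschemeι ≫ q).ker) (𝒜.U a) b) c) ∧
        (∀ (l : ℕ) (c : Γ(V, 𝒜.U a)), c ∈ (((((D.centre f i.ker).piece Dg).comap i).subschemeι ≫ q).ker).ideal (𝒜.U a) ^ l →
          ∃ c' : Γ(V', blowupChart ρ (((((D.centre f i.ker).piece Dg).comap i).subschemeι ≫ q).ker) (𝒜.U a) b),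
          c' * ρ.appLE (𝒜.U a) (blowupChart ρ (((((D.centre f i.ker).piece Dg).comap i).subschemeι ≫ q).ker) (𝒜.U a) b)
              (blowupChart_le_preimage ρ (((((D.centre f i.ker).piece Dg).comap i).subschemeι ≫ q).ker) (𝒜.U a) b) b ^ l =
            ρ.appLE (𝒜.U a) (blowupChart ρ (((((D.centre f i.ker).piece Dg).comap i).subschemeι ≫ q).ker) (𝒜.U a) b)
              (blowupChart_le_preimage ρ (((((D.centre f i.ker).piece Dg).comap i).subschemeι ≫ q).ker) (𝒜.U a) b) c) ∧
        Function.Injective (q'.app (blowupChart ρ (((((D.centre f i.ker).piece Dg).comap i).subschemeι ≫ q).ker) (𝒜.U a) b))) →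
    ∀ {p : ℕ} (D : WeightedResolutionDatum p) {k : Type} [Field k] [CharP k p] [PerfectField k]
      {Y X V : Scheme.{0}} (f : Y ⟶ Spec (.of k)) [Smooth f] [IsSeparated f] [QuasiCompact f]
      (i : X ⟶ Y) [IsClosedImmersion i] [IsIntegral X] (q : X ⟶ V) [IsIntegral V]
      (g : V ⟶ Spec (.of k)) [IsSeparated g] [LocallyOfFiniteType g] [QuasiCompact g],
      q ≫ g = i ≫ f →
      ∀ {j : ℕ} (𝒜 : GradedAtlas j f i q), (∃ y : Y, ¬ IsBot (D.inv f i.ker y)) →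
      (∀ (a : 𝒜.ι) (n : ℕ), @Ideal.IsHomogeneous (Fin j → ℤ) (AddSubgroup Γ(Y, 𝒜.W a))
        Γ(Y, 𝒜.W a) _ _ _ (𝒜.piece a) _ _ (𝒜.gradedRing a)
        (((D.centre f i.ker).piece n).ideal (𝒜.W a))) →
      ∀ (R' : ReesFiltration Y), R'.ideal = (D.centre f i.ker).piece →
      ∀ [Smooth (R'.πPlus ≫ f)] [IsSeparated (R'.πPlus ≫ f)] [QuasiCompact (R'.πPlus ≫ f)]
        [IsIntegral (R'.strictTransformPlus i.ker).subscheme]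
        (σX : (R'.strictTransformPlus i.ker).subscheme ⟶ X),
        σX ≫ i = (R'.strictTransformPlus i.ker).subschemeι ≫ R'.πPlus →
      ∀ (Dg : ℕ), 0 < Dg →
      ((D.centre f i.ker).piece Dg).comap R'.πPlus = R'.excPlus ^ Dg →
      (∀ (a : 𝒜.ι) (l : ℕ) (x : Γ(Y, 𝒜.W a)),
          x ∈ ((D.centre f i.ker).piece (Dg * (l + 1))).ideal (𝒜.W a) → x ∈ 𝒜.piece a 0 →
          ∃ y ∈ AddSubgroup.closure
            {z : Γ(Y, 𝒜.W a) | ∃ u v : Γ(Y, 𝒜.W a),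
              u ∈ ((D.centre f i.ker).piece Dg).ideal (𝒜.W a) ∧ u ∈ 𝒜.piece a 0 ∧
              v ∈ ((D.centre f i.ker).piece (Dg * l)).ideal (𝒜.W a) ∧ v ∈ 𝒜.piece a 0 ∧
              z = u * v},
            x - y ∈ i.ker.ideal (𝒜.W a)) →
      (((((D.centre f i.ker).piece Dg).comap i).subschemeι ≫ q).ker).comap (σX ≫ q) =
          (R'.excPlus.comap (R'.strictTransformPlus i.ker).subschemeι) ^ Dg →
      ∀ (V' : Scheme.{0}) (ρ : V' ⟶ V),
        IsBlowup ρ ((((D.centre f i.ker).piece Dg).comap i).subschemeι ≫ q).ker →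
        ∀ [IsIntegral V'] (q' : (R'.strictTransformPlus i.ker).subscheme ⟶ V'),
          q' ≫ ρ = σX ≫ q →
          Nonempty (GradedAtlas (j + 1) (R'.πPlus ≫ f)
            (R'.strictTransformPlus i.ker).subschemeι q') := by
  intro hamb hquot p D k _ _ _ Y X V f _ _ _ i _ _ q _ g _ _ _ hq j 𝒜 hguard hhom R' hR' _ _ _ _ σX hσX
    Dg hDg hexc hA2 hA3 V' ρ hρ _ q' hq'
  -- `q` is quasi-compact (it is so after composition with the separated `g`)
  haveI : QuasiCompact q := by
    haveI : QuasiCompact (q ≫ g) := by rw [hq]; infer_instance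
    exact .of_comp q g
  -- `V` is locally Noetherian (of finite type over the field `k`)
  haveI : IsLocallyNoetherian V := LocallyOfFiniteType.isLocallyNoetherian g
  -- `t⁻¹` is not identically zero on the integral strict transform `X'`
  have hτ := Lift.nonempty_preimage_basicOpen D f i hguard R' hR'
  -- (0) finitely many generators of the downstairs centre `K(U a)` on every chart
  choose s hs using fun a : 𝒜.ι =>
    exists_finset_span_eq (((((D.centre f i.ker).piece Dg).comap i).subschemeι ≫ q).ker) (𝒜.U a)
  have hbK : ∀ ab : (Σ a : 𝒜.ι, ↥(s a)), (ab.2 : Γ(V, 𝒜.U ab.1)) ∈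
      (((((D.centre f i.ker).piece Dg).comap i).subschemeι ≫ q).ker).ideal (𝒜.U ab.1) :=
    fun ab => (hs ab.1).le (Ideal.subset_span (Finset.mem_coe.mpr ab.2.2))
  -- (1) degree-zero lifts `β` of the generators, the ambient charts, the quotient charts
  have hβex : ∀ ab : (Σ a : 𝒜.ι, ↥(s a)), ∃ β : Γ(Y, 𝒜.W ab.1),
      β ∈ ((D.centre f i.ker).piece Dg).ideal (𝒜.W ab.1) ∧ β ∈ 𝒜.piece ab.1 0 ∧
        i.app (𝒜.W ab.1) β = q.appLE (𝒜.U ab.1) (i ⁻¹ᵁ (𝒜.W ab.1)) (𝒜.preimage_eq ab.1).le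
          (ab.2 : Γ(V, 𝒜.U ab.1)) :=
    fun ab => exists_degreeZero_lift 𝒜 (D.centre f i.ker).piece Dg ab.1 (hhom ab.1 Dg) (hbK ab)
  choose β hβJ hβ0 hβ using hβex
  choose 𝒞 h𝒞 using fun ab : (Σ a : 𝒜.ι, ↥(s a)) =>
    hamb D f i q g hq 𝒜 hguard hhom R' hR' Dg hDg hexc ab.1 (β ab) (hβJ ab) (hβ0 ab)
  have hQ := fun ab : (Σ a : 𝒜.ι, ↥(s a)) =>
    hquot D f i q g hq 𝒜 hguard R' hR' σX hσX Dg hDg hexc hA3 V' ρ hρ q' hq' ab.1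
      (ab.2 : Γ(V, 𝒜.U ab.1)) (hbK ab) (β ab) (hβ ab) (𝒞 ab) (h𝒞 ab)
  -- (2)-(5) the atlas
  refine ⟨{
    ι := Σ a : 𝒜.ι, ↥(s a)
    finite_ι := by haveI := 𝒜.finite_ι; infer_instance
    U := fun ab => ⟨blowupChart ρ (((((D.centre f i.ker).piece Dg).comap i).subschemeι ≫ q).ker)
      (𝒜.U ab.1) (ab.2 : Γ(V, 𝒜.U ab.1)), hρ.isAffineOpen_blowupChart (hbK ab)⟩
    iSup_eq_top := stub_qs_atlasCover hρ 𝒜.U 𝒜.iSup_eq_top s hs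
    W := fun ab => (𝒞 ab).W'
    preimage_eq := fun ab => (hQ ab).1
    piece := fun ab => (𝒞 ab).piece
    gradedRing := fun ab => (𝒞 ab).gradedRing
    appLE_mem := fun ab c => (𝒞 ab).const_mem c
    isHomogeneous_ker := fun ab => isHomogeneous_ker_chart (𝒞 ab)
    exists_preimage := fun ab s' hs' =>
      exists_preimage_chart 𝒜 (D.centre f i.ker).piece Dg hσX hτ hq' ab.1 (hβ ab) (𝒞 ab)
        (blowupChart_le_preimage ρ _ (𝒜.U ab.1) _) (hQ ab).1 (hA2 ab.1) (hQ ab).2.2.2.1 s' hs'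
    exists_lift := fun ab c' =>
      exists_lift_chart 𝒜 (D.centre f i.ker).piece Dg hσX hτ hq' ab.1 (hβ ab) (𝒞 ab)
        (blowupChart_le_preimage ρ _ (𝒜.U ab.1) _) (hQ ab).1 (D.centre f i.ker).piece_zero
        (D.centre f i.ker).piece_mul_le (hhom ab.1 Dg) (hQ ab).2.2.1 c'
    appLE_injective := fun ab => appLE_injective_of_eq _ (hQ ab).1 (hQ ab).2.2.2.2
    exponent := 𝒜.exponent * Dg
    exponent_pos := Nat.mul_pos 𝒜.exponent_pos hDg
    exists_unit := ?_ }⟩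
  · -- homogeneous units of all degrees in `(e Dg)·ℤʲ⁺¹` near every point of `X'`
    intro x'
    obtain ⟨a, hxa, hunits⟩ := 𝒜.exists_unit (σX x')
    have hqx : ρ (q' x') ∈ (𝒜.U a : V.Opens) := by
      have e1 : (q' ≫ ρ) x' = ρ (q' x') := Scheme.Hom.comp_apply _ _ _
      rw [← e1, hq', Scheme.Hom.comp_apply]
      change σX x' ∈ q ⁻¹ᵁ (𝒜.U a : V.Opens)
      rw [← 𝒜.preimage_eq a]
      exact hxa
    obtain ⟨b, hb⟩ := exists_mem_blowupChart hρ (𝒜.U a) (s a) (hs a) hqx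
    refine ⟨⟨a, b⟩, ?_, fun χ' => exists_unit_chart hσX (𝒞 ⟨a, b⟩) 𝒜.exponent hunits χ'⟩
    have h : x' ∈ q' ⁻¹ᵁ blowupChart ρ _ (𝒜.U a) (b : Γ(V, 𝒜.U a)) := hb
    rw [← (hQ ⟨a, b⟩).1] at h
    exact h

end Summit.ResolutionOfSingularities.ResolutionOfSingularities.Theorems.DatumToEmbedded.Atlas

end
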